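import Summits.AtomisticToContinuum.Crystallization.Theorems.FrustratedLawDichotomyStrainedPatchHomValueT2SlopeSoundC
import Summits.AtomisticToContinuum.Crystallization.Theorems.FrustratedLawDichotomyStrainedPatchHomValueT2SlopeSoundN

/-!
# (I1) slope part O — ★★★ `slopeLeafT2_sound`: THE `hslope` INPUT FROM THE SLOPE REPORT (`…HomValueT2Track` §14b `t2SlopeT2`; critic row 1674 (B) (I1)
# docket item 3; 27623 `(H) HomFloor`, hcp half; decomp-a2c hand-1 g49)

Far labels carry no force (`W₄₅′ ≡ 0` beyond `9/2`: `boxForceB_eq_nearSum`), so the `hcp`-family slope term over the whole `[−7,7]³` box is the near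
`B`-family `y`-space force paired with `Δ` (part C), and part N bounds each component: for the slope fold of `t2SlopeT2 c w aP` (part K: flag = `.1`,
`G`-triple = `.2.1`) with flag `true`, every self-adjoint `U` in the entry box of `(c, trackW aP w)` and `ξ` in the track box on the graph,
  `|Σ_{b ∈ [−7,7]³} segG W₄₅′ (p_b(U, ξ)) Δ 0| ≤ (√(Σ_a (G_a + 41·#nearB)²)/SC)·‖Δ‖` —
the `hslope` shape of `…HomSignedWell.hcpEnergy_of_ballLeaves_signed` (with the floor correction of parts I/J; `41·#nearB ≤ 1.4·10⁵` ulps).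
No definitions; 0 sorry; standard axioms.  `--supports stmt-AtomisticToContinuum-27623`.
-/

noncomputable section

namespace Summit.AtomisticToContinuum.Crystallization.Theorems.FrustratedLawDichotomyStrainedPatchHomValueT2Kit

open scoped BigOperators RealInnerProductSpace
open Finset
open Literature.Analysis.ValidatedNumerics.Numerics
open Summit.AtomisticToContinuum.Crystallization.Theorems.ChargedEnergyGapNegative (E3)
open Summit.AtomisticToContinuum.Crystallization.Theorems.FrustratedLawDichotomySchurCut (effPot w₄₅ ω₄)
open Summit.AtomisticToContinuum.Crystallization.Theorems.FrustratedLawDichotomyStrainedPatchTaylorLeaves (junctions)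
open Summit.AtomisticToContinuum.Crystallization.Theorems.FrustratedLawDichotomyStrainedPatchTaylorChord (segG)
open Summit.AtomisticToContinuum.Crystallization.Theorems.FrustratedLawDichotomyStrainedPatchHomSplit (latPt hexFrame hcpShift)
open Summit.AtomisticToContinuum.Crystallization.Theorems.FrustratedLawDichotomyStrainedPatchHomTermCalculus (deriv_effPot45_far)
open Summit.AtomisticToContinuum.Crystallization.Theorems.FrustratedLawDichotomyStrainedPatchHomEntryGramHcp (dot3 shufFI)
open Summit.AtomisticToContinuum.Crystallization.Theorems.FrustratedLawDichotomyStrainedPatchHomCurvLeaf (boxLabels7 boxLabels7_toFinset)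
open Summit.AtomisticToContinuum.Crystallization.Theorems.FrustratedLawDichotomyStrainedPatchHomCurvCentreKit (boxE cenE cenX cenMap cenShuf)

/-- ★ **`B`-family force**: the component sum over `[−7,7]³` equals the sum over `(nearB c w).toFinset` (far labels: `W₄₅′ = 0`). [folklore chaining] -/
theorem boxForceB_eq_nearSum {c w : (Fin 3 × Fin 3) ⊕ Fin 3 → ℤ} (U : E3 →L[ℝ] E3)
    (hbox : ∀ ab : Fin 3 × Fin 3, |(U (EuclideanSpace.single ab.2 (1 : ℝ))) ab.1 - (c (Sum.inl ab) : ℝ) / SC| ≤ (w (Sum.inl ab) : ℝ) / SC)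
    (ξ : E3) (hξ : ∀ i : Fin 3, |ξ i - (c (Sum.inr i) : ℝ) / SC| ≤ (w (Sum.inr i) : ℝ) / SC) (a : Fin 3) :
    ∑ b ∈ (Fintype.piFinset fun _ : Fin 3 => Finset.Icc (-7 : ℤ) 7), deriv (effPot w₄₅ ω₄ (3 / 400)) ‖(latPt U hexFrame b + U (hcpShift + ξ))‖ / ‖(latPt U hexFrame b + U (hcpShift + ξ))‖ * (latPt U hexFrame b + U (hcpShift + ξ)) a =
      ∑ b ∈ (nearB c w).toFinset, deriv (effPot w₄₅ ω₄ (3 / 400)) ‖(latPt U hexFrame b + U (hcpShift + ξ))‖ / ‖(latPt U hexFrame b + U (hcpShift + ξ))‖ * (latPt U hexFrame b + U (hcpShift + ξ)) a := by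
  classical
  rw [← boxLabels7_toFinset]
  symm
  refine Finset.sum_subset (fun b hb => List.mem_toFinset.2 (mem_boxLabels7_of_mem_nearB (List.mem_toFinset.1 hb))) ?_
  intro b hb hnot
  rw [deriv_effPot45_far (farB_of_not_nearB (List.mem_toFinset.1 hb) (fun h => hnot (List.mem_toFinset.2 h)) U ξ hbox hξ), zero_div, zero_mul]

/-- ★★★ **`slopeLeafT2_sound` — THE `hslope` INPUT FROM THE SECOND-ORDER SLOPE REPORT AT THE TRACK.** [folklore chaining: `boxForceB_eq_nearSum`,
part N `slope_component_bound`, part C `slopeSum_abs_le_l2_SC`] -/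
theorem slopeLeafT2_sound {c w : (Fin 3 × Fin 3) ⊕ Fin 3 → ℤ} {aP : Fin 3 → Fin 6 → ℤ} (hflag : ((nearB c (trackW aP w)).foldl (fun A b =>
        match mkDRec 9 (cenE c) (qB (cenX c) b), mkDRec 9 (boxE c (trackW aP w)) (qB (shufFI c (trackW aP w)) b) with
        | some Rp, some Rb => accSlope aP (Array.ofFn fun p : Fin 9 => foldW (trackW aP w) p) Rp Rb A
        | _, _ => (⟨false, A.fc, A.jc, A.hp, A.rp⟩ : AccS)) (⟨true, zeroArr 3, zeroArr 18, Array.replicate 3 0, Array.replicate 3 0⟩ : AccS)).ok = true)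
    (hc : ∀ a b : Fin 3, c (Sum.inl (a, b)) = c (Sum.inl (b, a)))
    (hwpos : ∀ p : Fin 9, 0 < foldW (trackW aP w) p) (hw1 : ∀ p : Fin 9, foldW (trackW aP w) p ≤ (SC : ℤ))
    (U : E3 →L[ℝ] E3) (ξ : E3) (hsa : ∀ v v' : E3, ⟪U v, v'⟫ = ⟪v, U v'⟫)
    (hbox : ∀ ab : Fin 3 × Fin 3, |(U (EuclideanSpace.single ab.2 (1 : ℝ))) ab.1 - (c (Sum.inl ab) : ℝ) / SC| ≤ ((trackW aP w) (Sum.inl ab) : ℝ) / SC)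
    (hξ : ∀ i : Fin 3, |ξ i - (c (Sum.inr i) : ℝ) / SC| ≤ ((trackW aP w) (Sum.inr i) : ℝ) / SC)
    (A : ℕ → ℕ → ℝ) (hA : ∀ m e (hm : m < 3) (he : e < 6), A m e = ((aP ⟨m, hm⟩ ⟨e, he⟩ : ℤ) : ℝ) / SC)
    (hgraph : ∀ m, m < 3 → dispN (U - cenMap c) (ξ - cenShuf c) (6 + m) = ∑ e ∈ range 6, A m e * dispN (U - cenMap c) (ξ - cenShuf c) e)
    (hJB : ∀ b ∈ (nearB c (trackW aP w)), ‖latPt (cenMap c) hexFrame b + cenMap c (hcpShift + cenShuf c)‖ ∉ junctions) (Δ : E3) :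
    |∑ b ∈ (Fintype.piFinset fun _ : Fin 3 => Finset.Icc (-7 : ℤ) 7), segG (deriv (effPot w₄₅ ω₄ (3 / 400))) (latPt U hexFrame b + U (hcpShift + ξ)) Δ 0| ≤
      Real.sqrt (∑ a : Fin 3, (((((((nearB c (trackW aP w)).foldl (fun A b =>
        match mkDRec 9 (cenE c) (qB (cenX c) b), mkDRec 9 (boxE c (trackW aP w)) (qB (shufFI c (trackW aP w)) b) with
        | some Rp, some Rb => accSlope aP (Array.ofFn fun p : Fin 9 => foldW (trackW aP w) p) Rp Rb A
        | _, _ => (⟨false, A.fc, A.jc, A.hp, A.rp⟩ : AccS)) (⟨true, zeroArr 3, zeroArr 18, Array.replicate 3 0, Array.replicate 3 0⟩ : AccS)).fc.getD a.val fi0).absHi + cdiv ((List.range 6).foldl (fun s e => s + (((nearB c (trackW aP w)).foldl (fun A b =>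
        match mkDRec 9 (cenE c) (qB (cenX c) b), mkDRec 9 (boxE c (trackW aP w)) (qB (shufFI c (trackW aP w)) b) with
        | some Rp, some Rb => accSlope aP (Array.ofFn fun p : Fin 9 => foldW (trackW aP w) p) Rp Rb A
        | _, _ => (⟨false, A.fc, A.jc, A.hp, A.rp⟩ : AccS)) (⟨true, zeroArr 3, zeroArr 18, Array.replicate 3 0, Array.replicate 3 0⟩ : AccS)).jc.getD (6 * a.val + e) fi0).absHi * (Array.ofFn fun p : Fin 9 => foldW (trackW aP w) p).getD e 0) 0) (SC : ℤ) + cdiv (((nearB c (trackW aP w)).foldl (fun A b =>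
        match mkDRec 9 (cenE c) (qB (cenX c) b), mkDRec 9 (boxE c (trackW aP w)) (qB (shufFI c (trackW aP w)) b) with
        | some Rp, some Rb => accSlope aP (Array.ofFn fun p : Fin 9 => foldW (trackW aP w) p) Rp Rb A
        | _, _ => (⟨false, A.fc, A.jc, A.hp, A.rp⟩ : AccS)) (⟨true, zeroArr 3, zeroArr 18, Array.replicate 3 0, Array.replicate 3 0⟩ : AccS)).hp.getD a.val 0) (SC : ℤ) + cdiv (((nearB c (trackW aP w)).foldl (fun A b =>
        match mkDRec 9 (cenE c) (qB (cenX c) b), mkDRec 9 (boxE c (trackW aP w)) (qB (shufFI c (trackW aP w)) b) with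
        | some Rp, some Rb => accSlope aP (Array.ofFn fun p : Fin 9 => foldW (trackW aP w) p) Rp Rb A
        | _, _ => (⟨false, A.fc, A.jc, A.hp, A.rp⟩ : AccS)) (⟨true, zeroArr 3, zeroArr 18, Array.replicate 3 0, Array.replicate 3 0⟩ : AccS)).rp.getD a.val 0) (2 * (SC : ℤ))) + 41 * ((nearB c (trackW aP w)).length : ℤ) : ℤ)) : ℝ) ^ 2) / SC * ‖Δ‖ := by
  refine slopeSum_abs_le_l2_SC (Fintype.piFinset fun _ : Fin 3 => Finset.Icc (-7 : ℤ) 7) (deriv (effPot w₄₅ ω₄ (3 / 400))) (fun b => (latPt U hexFrame b + U (hcpShift + ξ)))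
    (fun a => ((((nearB c (trackW aP w)).foldl (fun A b =>
        match mkDRec 9 (cenE c) (qB (cenX c) b), mkDRec 9 (boxE c (trackW aP w)) (qB (shufFI c (trackW aP w)) b) with
        | some Rp, some Rb => accSlope aP (Array.ofFn fun p : Fin 9 => foldW (trackW aP w) p) Rp Rb A
        | _, _ => (⟨false, A.fc, A.jc, A.hp, A.rp⟩ : AccS)) (⟨true, zeroArr 3, zeroArr 18, Array.replicate 3 0, Array.replicate 3 0⟩ : AccS)).fc.getD a.val fi0).absHi + cdiv ((List.range 6).foldl (fun s e => s + (((nearB c (trackW aP w)).foldl (fun A b =>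
        match mkDRec 9 (cenE c) (qB (cenX c) b), mkDRec 9 (boxE c (trackW aP w)) (qB (shufFI c (trackW aP w)) b) with
        | some Rp, some Rb => accSlope aP (Array.ofFn fun p : Fin 9 => foldW (trackW aP w) p) Rp Rb A
        | _, _ => (⟨false, A.fc, A.jc, A.hp, A.rp⟩ : AccS)) (⟨true, zeroArr 3, zeroArr 18, Array.replicate 3 0, Array.replicate 3 0⟩ : AccS)).jc.getD (6 * a.val + e) fi0).absHi * (Array.ofFn fun p : Fin 9 => foldW (trackW aP w) p).getD e 0) 0) (SC : ℤ) + cdiv (((nearB c (trackW aP w)).foldl (fun A b =>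
        match mkDRec 9 (cenE c) (qB (cenX c) b), mkDRec 9 (boxE c (trackW aP w)) (qB (shufFI c (trackW aP w)) b) with
        | some Rp, some Rb => accSlope aP (Array.ofFn fun p : Fin 9 => foldW (trackW aP w) p) Rp Rb A
        | _, _ => (⟨false, A.fc, A.jc, A.hp, A.rp⟩ : AccS)) (⟨true, zeroArr 3, zeroArr 18, Array.replicate 3 0, Array.replicate 3 0⟩ : AccS)).hp.getD a.val 0) (SC : ℤ) + cdiv (((nearB c (trackW aP w)).foldl (fun A b =>
        match mkDRec 9 (cenE c) (qB (cenX c) b), mkDRec 9 (boxE c (trackW aP w)) (qB (shufFI c (trackW aP w)) b) with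
        | some Rp, some Rb => accSlope aP (Array.ofFn fun p : Fin 9 => foldW (trackW aP w) p) Rp Rb A
        | _, _ => (⟨false, A.fc, A.jc, A.hp, A.rp⟩ : AccS)) (⟨true, zeroArr 3, zeroArr 18, Array.replicate 3 0, Array.replicate 3 0⟩ : AccS)).rp.getD a.val 0) (2 * (SC : ℤ))) + 41 * ((nearB c (trackW aP w)).length : ℤ)) (fun a => ?_) Δ
  rw [boxForceB_eq_nearSum U hbox ξ hξ a]
  have h := slope_component_bound hflag hc hwpos hw1 U ξ hsa hbox hξ A hA hgraph hJB a
  push_cast at h ⊢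
  exact h

end Summit.AtomisticToContinuum.Crystallization.Theorems.FrustratedLawDichotomyStrainedPatchHomValueT2Kit
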